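import Summits.QuantumFields.BalabanUV.T4Continuum.Support.NE7QbarLipschitzTower
import Summits.QuantumFields.BalabanUV.T4Continuum.Support.NE3SmoothRightInverseFlat
import Literature.MathematicalPhysics.QuantumFieldTheory.Balaban1983to89.B7Prop5Flat
import HarnessLib

/-!
# NE7QcoarseCutoffStraight — THE STRAIGHT AVERAGE OF A CUT-OFF STRAIGHT TANGENT LIVES ON THE SHELL: for `Y` with `(Qcoarse L)^[k+1] Y = 0` and a scalar weight `g`
# that is CONSTANT on the level box of every coarse bond not covered by a site set `S`, `‖Q^{k+1}(g·Y)(w,τ)‖ ≤ ‖Q^{k+1}(1_S·g·Y)(w,τ)‖` at EVERY coarse bond, hence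
# `Σ_{w∈[0,N)^d}Σ_τ ‖Q^{k+1}(g·Y)(w,τ)‖ ≤ (L∕L^d)^{k+1}·‖Y‖_{ℓ¹(periodBox ∩ S)}` (`|g| ≤ 1`) — the commutator `[Q^{k+1}, g]` costs only the far mass

Cell `pub-balaban`, rung (B)+1 sub-cell t4, lineage `b2b-balaban-t4-ne7-p1` (CRUX PROVER NE7 #1 = OWNER of row NE7), generation 89; memo
`t4/b2b-balaban-t4-ne7-p1-g89/COSTING-N1.md` §7 ((N2)-straight, brick (f)).  File F266 (over F50 `NE7QbarLipschitzTower.sum_norm_iterate_Qcoarse_le` (the flat tower's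
`ℓ¹` norm `q^{k+1}`), row NE3's `iterate_Qcoarse_apply` (`Q^{(k)} = linQ (L^k)` at the corners), lit-balaban's `B7Prop5Flat.linQ_congr` (locality of (125)) and
`B7Prop3Flat.linQ_smul`).

WHY (memo §7).  In the v4 defect assembly the critical pairing is bounded by `c_R‖Q̄_{U′}(χ′Y)‖₁`, split as `(Q̄_{U′} − Q̄_1)(χ′Y)` (Lipschitz budget, small factor `Mα₀`)
plus `Q̄_1(χ′Y) = Q^{k+1}(χ′Y)`; for a STRAIGHT tangent `Y` the latter vanishes at every coarse bond whose level box sees a constant `χ′`, and at the remaining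
(shell) bonds it equals `Q^{k+1}` of the field cut down to the shell `S` — so its `ℓ¹` norm is the flat tower norm of the far mass, with NO oscillation constant.
WHAT ([folklore]; 0 def, 0 sorry; generic `d`).
§1 `slab_of_inBox_bondHi`, `agreeOn_bondHi_of_slab` (the one-step box of the `M`-bond over `(w,τ)` in slab form `Mw_i ≤ x_i ≤ Mw_i + 2M − 1`).
§2 **`norm_iterate_Qcoarse_weight_le`** (pointwise, every coarse bond), §3 **`sum_norm_iterate_Qcoarse_weight_le`** (the torus sum `≤ q^{k+1}·‖Y‖_{1,S}`).
HONEST FRAMING (page 1): flat kinematics; nothing of Bałaban's asserted; NOT (APE), NOT ONE-STEP, NOT NE7; spine 0∕9; finite T⁴ rung (B)+1 — NOT infinite volume, NOT mass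
gap, NOT `BetaPertH`, NOT Clay.  Continuum YM on T⁴ ⇐ BetaPertH ∧ nine spine estimates (0/9 proved); BetaPertH ⇐ (D1) ∧ (D4) ∧ CAP+tail; G-an2-4 gates asym, D1 and
NE2/3/4.
-/

set_option autoImplicit false

open scoped BigOperators Matrix.Norms.L2Operator
open NormedSpace Finset

namespace Summit.QuantumFields.BalabanUV.T4Continuum.NE7QcoarseCutoffStraight

open Literature.MathematicalPhysics.QuantumFieldTheory.Balaban1983to89
open B7Prop1Explicit B7Prop2Explicit MatrixLog
open B7Prop1Local (InBox AgreeOn bondHi add_zsmul_e_apply add_e_apply)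
open B7Prop3Flat (linQ linQ_smul)
open B7Prop5Flat (linQ_congr)
open T4AveragingDeficitWall (dirL1)
open T4AveragingDeficitWallBoundary (periodBox)
open AveragingDeficitPeriodicCounting (IsPeriodicDir)
open NE3TangentFlatStructure (Qcoarse)
open NE3SmoothRightInverseFlat (iterate_Qcoarse_apply)
open NE7QbarLipschitzTower (sum_norm_iterate_Qcoarse_le)

noncomputable section

variable {d : ℕ} {n : Type*} [Fintype n] [DecidableEq n]

/-! ## §1 The one-step box of an `M`-bond in slab form -/

section Slab

variable {G : Type*}

omit [Fintype n] [DecidableEq n] in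
/-- A site of the box `[M•w, bondHi M (M•w) τ]` satisfies `Mw_i ≤ x_i ≤ Mw_i + 2M − 1`. [folklore] -/
theorem slab_of_inBox_bondHi (M : ℕ) (w : Site d) (τ : Fin d) {x : Site d} (hx : InBox ((M : ℤ) • w) (bondHi M ((M : ℤ) • w) τ) x) (i : Fin d) :
    (M : ℤ) * w i ≤ x i ∧ x i ≤ (M : ℤ) * w i + 2 * (M : ℤ) - 1 := by
  have h := hx i
  have hM : (0 : ℤ) ≤ (M : ℤ) := by positivity
  simp only [bondHi, Pi.smul_apply, smul_eq_mul] at h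
  constructor
  · exact h.1
  · split_ifs at h <;> omega

omit [Fintype n] [DecidableEq n] in
/-- Fields agreeing on every bond based in the slab agree on the box `[M•w, bondHi M (M•w) τ]`. [folklore] -/
theorem agreeOn_bondHi_of_slab (M : ℕ) (w : Site d) (τ : Fin d) {F F' : Site d → Fin d → G}
    (h : ∀ (x : Site d) (μ : Fin d), (∀ i, (M : ℤ) * w i ≤ x i ∧ x i ≤ (M : ℤ) * w i + 2 * (M : ℤ) - 1) → F x μ = F' x μ) :
    AgreeOn ((M : ℤ) • w) (bondHi M ((M : ℤ) • w) τ) F F' := fun x μ hx _ =>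
  h x μ (slab_of_inBox_bondHi M w τ hx)

end Slab

/-! ## §2 Pointwise: constant boxes give zero, shell boxes see only the shell -/

/-- **`‖Q^{k+1}(g·Y)(w,τ)‖ ≤ ‖Q^{k+1}(1_S·g·Y)(w,τ)‖`** for a straight tangent `Y` (`(Qcoarse L)^[k+1] Y = 0`), at every coarse bond `(w,τ)` whose level box (slab
`Mw_i ≤ x_i ≤ Mw_i + 2M − 1`, `M = L^{k+1}`) either sees a CONSTANT weight `g ≡ g₀` (then the left side is `g₀·Q^{k+1}Y(w,τ) = 0`) or is covered by `S` (then the two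
sides are equal by locality of (125)). [folklore] -/
theorem norm_iterate_Qcoarse_weight_le (L k : ℕ) {Y : Site d → Fin d → Matrix n n ℂ} (hYQ : (Qcoarse L)^[k + 1] Y = 0) (g : Site d → ℝ)
    (S : Site d → Prop) [DecidablePred S] (w : Site d) (τ : Fin d)
    (hbox : (∃ g₀ : ℝ, ∀ x : Site d, (∀ i, ((L ^ (k + 1) : ℕ) : ℤ) * w i ≤ x i ∧ x i ≤ ((L ^ (k + 1) : ℕ) : ℤ) * w i + 2 * ((L ^ (k + 1) : ℕ) : ℤ) - 1) → g x = g₀)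
      ∨ (∀ x : Site d, (∀ i, ((L ^ (k + 1) : ℕ) : ℤ) * w i ≤ x i ∧ x i ≤ ((L ^ (k + 1) : ℕ) : ℤ) * w i + 2 * ((L ^ (k + 1) : ℕ) : ℤ) - 1) → S x)) :
    ‖(Qcoarse L)^[k + 1] (fun (x : Site d) (μ : Fin d) => g x • Y x μ) w τ‖
      ≤ ‖(Qcoarse L)^[k + 1] (fun (x : Site d) (μ : Fin d) => if S x then g x • Y x μ else 0) w τ‖ := by
  rw [iterate_Qcoarse_apply, iterate_Qcoarse_apply]
  rcases hbox with ⟨g₀, hg₀⟩ | hS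
  · -- constant weight on the box: `linQ M (g·Y) = linQ M (g₀•Y) = g₀•linQ M Y = g₀•Q^{k+1}Y(w,τ) = 0`
    have hagree : AgreeOn (((L ^ (k + 1) : ℕ) : ℤ) • w) (bondHi (L ^ (k + 1)) (((L ^ (k + 1) : ℕ) : ℤ) • w) τ)
        (fun (x : Site d) (μ : Fin d) => g x • Y x μ) (g₀ • Y) :=
      agreeOn_bondHi_of_slab (L ^ (k + 1)) w τ fun x μ hx => by simp only [Pi.smul_apply, hg₀ x hx]
    have hz := congrFun (congrFun hYQ w) τ
    rw [iterate_Qcoarse_apply] at hz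
    rw [linQ_congr (L ^ (k + 1)) _ τ hagree, linQ_smul, hz, Pi.zero_apply, Pi.zero_apply, smul_zero, norm_zero]
    exact norm_nonneg _
  · -- the box is covered by `S`: the two fields agree on it
    have hagree : AgreeOn (((L ^ (k + 1) : ℕ) : ℤ) • w) (bondHi (L ^ (k + 1)) (((L ^ (k + 1) : ℕ) : ℤ) • w) τ)
        (fun (x : Site d) (μ : Fin d) => g x • Y x μ) (fun (x : Site d) (μ : Fin d) => if S x then g x • Y x μ else 0) :=
      agreeOn_bondHi_of_slab (L ^ (k + 1)) w τ fun x μ hx => by rw [if_pos (hS x hx)]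
    rw [linQ_congr (L ^ (k + 1)) _ τ hagree]

/-! ## §3 The torus sum: the flat tower norm of the far mass -/

/-- **`Σ_{w∈[0,N)^d}Σ_τ ‖Q^{k+1}(g·Y)(w,τ)‖ ≤ (L∕L^d)^{k+1}·‖Y‖_{ℓ¹(periodBox(L^{k+1}N) ∩ S)}`** for a straight tangent `Y` (`(L^{k+1}N)`-periodic, `(Qcoarse L)^[k+1] Y = 0`),
a periodic weight `|g| ≤ 1` and a periodic site set `S` such that every coarse bond's level box either sees a constant `g` or is covered by `S` (§2 + F50's flat tower
norm applied to the periodic field `1_S·g·Y`). [folklore] -/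
theorem sum_norm_iterate_Qcoarse_weight_le [Nonempty n] {L : ℕ} (hL : 1 ≤ L) (k : ℕ) {N : ℕ} (hN : 1 ≤ N)
    {Y : Site d → Fin d → Matrix n n ℂ} (hYP : IsPeriodicDir Y (((L ^ (k + 1) * N : ℕ) : ℤ))) (hYQ : (Qcoarse L)^[k + 1] Y = 0)
    (g : Site d → ℝ) (hgP : ∀ (x : Site d) (i : Fin d), g (x + ((L ^ (k + 1) * N : ℕ) : ℤ) • e i) = g x) (hg1 : ∀ x : Site d, |g x| ≤ 1)
    (S : Site d → Prop) [DecidablePred S] (hSP : ∀ (x : Site d) (i : Fin d), S (x + ((L ^ (k + 1) * N : ℕ) : ℤ) • e i) ↔ S x)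
    (hbox : ∀ (w : Site d) (τ : Fin d),
      (∃ g₀ : ℝ, ∀ x : Site d, (∀ i, ((L ^ (k + 1) : ℕ) : ℤ) * w i ≤ x i ∧ x i ≤ ((L ^ (k + 1) : ℕ) : ℤ) * w i + 2 * ((L ^ (k + 1) : ℕ) : ℤ) - 1) → g x = g₀)
      ∨ (∀ x : Site d, (∀ i, ((L ^ (k + 1) : ℕ) : ℤ) * w i ≤ x i ∧ x i ≤ ((L ^ (k + 1) : ℕ) : ℤ) * w i + 2 * ((L ^ (k + 1) : ℕ) : ℤ) - 1) → S x)) :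
    ∑ w ∈ periodBox N, ∑ τ : Fin d, ‖(Qcoarse L)^[k + 1] (fun (x : Site d) (μ : Fin d) => g x • Y x μ) w τ‖
      ≤ ((L : ℝ) / (L : ℝ) ^ d) ^ (k + 1) * dirL1 Y ((periodBox (d := d) (L ^ (k + 1) * N)).filter (fun x => S x)) := by
  set F : Site d → Fin d → Matrix n n ℂ := fun x μ => if S x then g x • Y x μ else 0 with hF
  have hFP : IsPeriodicDir F (((L ^ (k + 1) * N : ℕ) : ℤ)) := by
    intro x i μ
    simp only [hF, hSP x i, hgP x i, hYP x i μ]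
  have h1 : ∑ w ∈ periodBox N, ∑ τ : Fin d, ‖(Qcoarse L)^[k + 1] (fun (x : Site d) (μ : Fin d) => g x • Y x μ) w τ‖
      ≤ ∑ w ∈ periodBox N, ∑ τ : Fin d, ‖(Qcoarse L)^[k + 1] F w τ‖ :=
    Finset.sum_le_sum fun w _ => Finset.sum_le_sum fun τ _ => norm_iterate_Qcoarse_weight_le L k hYQ g S w τ (hbox w τ)
  have h2 := sum_norm_iterate_Qcoarse_le (d := d) (n := n) hL (k + 1) hN F hFP
  have h3 : dirL1 F (periodBox (d := d) (L ^ (k + 1) * N)) ≤ dirL1 Y ((periodBox (d := d) (L ^ (k + 1) * N)).filter (fun x => S x)) := by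
    unfold dirL1
    rw [Finset.sum_filter]
    refine Finset.sum_le_sum fun x _ => ?_
    by_cases hx : S x
    · rw [if_pos hx]
      refine Finset.sum_le_sum fun μ _ => ?_
      simp only [hF, if_pos hx]
      rw [norm_smul, Real.norm_eq_abs]
      have := hg1 x
      have h0 := norm_nonneg (Y x μ)
      nlinarith
    · rw [if_neg hx]
      refine le_of_eq (Finset.sum_eq_zero fun μ _ => ?_)
      simp only [hF, if_neg hx, norm_zero]
  have hq0 : 0 ≤ ((L : ℝ) / (L : ℝ) ^ d) ^ (k + 1) := by positivity
  exact h1.trans (h2.trans (mul_le_mul_of_nonneg_left h3 hq0))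

end

end Summit.QuantumFields.BalabanUV.T4Continuum.NE7QcoarseCutoffStraight
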